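import Literature.Barriers.CriticalPhenomena.SAPSectionLines
import Literature.Barriers.CriticalPhenomena.SAPRowRational
import Literature.Barriers.CriticalPhenomena.SAPAnisotropicNotDFinite242Recurrence
import Mathlib.RingTheory.PrincipalIdealDomain
import HarnessLib

/-!
# Rechnitzer's Corollary 13 from its printed inputs: Theorem 1 (proved), Theorem 6, Lemma 10,
# Theorem 12

Companion of `SAPAnisotropicNotDFinite242Recurrence`, which vendors **Corollary 13** of
A. Rechnitzer, *Haruspicy 2* (J. Combin. Theory Ser. A 113 (2006); arXiv:math/0406450v2) as the
named fact `Rechnitzer2006_cor13` — "The factor of `Ψ_k(x)` in the denominator, `D_n(x)` of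
`H_n(x)` may not appear with a power greater than `2n-6k+5`. Hence we have the following
multiplicative upper bound for `D_n(x)`: `D_n(x) ∣ ∏_{k=1}^{⌈n/3⌉} Ψ_k(x)^{2n-6k+5}`", read as
"`B_n · H_n ∈ ℚ[x]`" with `B_n = denomBound n` — and of `SAPSectionLines`, which defines the
sections and section-minimal polygons of §2.1 and vendors the printed inputs of the corollary
("This follows by combining the results of Theorems 1, 6 and 12"): `Rechnitzer2006_thm6`,
`Rechnitzer2006_lem10` (by which the product stops at `⌈n/3⌉`), `Rechnitzer2006_thm12`;
Theorem 1 is PROVED in `SAPRowRational` (`Rechnitzer2006_thm1_holds`).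

This file PROVES the assembly
`Rechnitzer2006_cor13_of_thm6_lem10_thm12 : thm6 → lem10 → thm12 → Rechnitzer2006_cor13`,
i.e. the printed proof of Corollary 13: write `H_n = N/D` in lowest terms (Theorem 1 and
`gcd`); for `k ≥ 1`, if `Ψ_k^α ∣ D` with `α ≥ 1` then (Theorem 6) some section-minimal polygon
with `2n` vertical bonds has `α` sections with `2K` horizontal bonds, `k ∣ K`; if `3k ≤ n+2`,
Theorem 12 with `2n = 6k-4+2M`, `M = n+2-3k`, bounds their number by `2M+1 = 2n+5-6k`; if
`3k > n+2`, Lemma 10 (`6K-4 ≤ 2n`) excludes them. So every `Ψ_k` has exponent at most that of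
`B_n` in `D`, and `D`, which divides a product of cyclotomic polynomials (Theorem 1), divides
`B_n` (`dvd_prod_cyclotomic_pow_of_forall_le`: induction on that product, the `Ψ_j` being prime
in `ℚ[x]`), whence `B_n H_n = (B_n/D) · N`.

Consequently `Rechnitzer2006_thm16` (and with it the simplicity half of Theorem 16) rests, through
`Rechnitzer2006_thm16_of_cor13_lem20_lem25`, on Theorems 6 and 12, Lemma 10, Lemma 20 and
Lemma 25 — all statements about sections, the objects now defined in `SAPSectionLines`.

## References

* A. Rechnitzer, *Haruspicy 2*, J. Combin. Theory Ser. A 113 (2006) 520–546, §2.2, Corollary 13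
  and its proof. [Rechnitzer2006Haruspicy2]
-/

noncomputable section

open Finset PowerSeries Literature.Probability.LatticeModels
open scoped BigOperators Polynomial

namespace Literature.Barriers.CriticalPhenomena

open Haruspicy

/-! ### Divisors of a product of cyclotomic polynomials with bounded exponents -/

/-- **Bounded cyclotomic exponents.** If `E ∈ ℚ[x]` divides a product `∏_{j ∈ t} Ψ_j` of
cyclotomic polynomials and, for every `k ≥ 1`, `Ψ_k^α ∣ E` forces `α ≤ f k`, then `E` divides
`∏_{k ∈ F} Ψ_k^{f k}` for any finite `F` containing the indices of `t` (induction on `t`: each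
`Ψ_j`, `j ≥ 1`, is prime in `ℚ[x]`, `Polynomial.cyclotomic.irreducible_rat`; `Ψ_0 = 1`). [folklore] -/
theorem dvd_prod_cyclotomic_pow_of_forall_le (t : Multiset ℕ) :
    ∀ (E : ℚ[X]) (f : ℕ → ℕ) (F : Finset ℕ), t.toFinset ⊆ F →
      E ∣ (t.map fun k => Polynomial.cyclotomic k ℚ).prod →
      (∀ k, 1 ≤ k → ∀ α, Polynomial.cyclotomic k ℚ ^ α ∣ E → α ≤ f k) →
        E ∣ ∏ k ∈ F, Polynomial.cyclotomic k ℚ ^ f k := by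
  classical
  induction t using Multiset.induction_on with
  | empty =>
    intro E f F _ hE _
    simp only [Multiset.map_zero, Multiset.prod_zero] at hE
    exact (isUnit_of_dvd_one hE).dvd
  | cons j t ih =>
    intro E f F hF hE hb
    rw [Multiset.toFinset_cons, Finset.insert_subset_iff] at hF
    rw [Multiset.map_cons, Multiset.prod_cons] at hE
    by_cases hj : j = 0
    · subst hj
      rw [Polynomial.cyclotomic_zero, one_mul] at hE
      exact ih E f F hF.2 hE hb
    have hjpos : 0 < j := Nat.pos_of_ne_zero hj
    have hirr : Irreducible (Polynomial.cyclotomic j ℚ) :=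
      Polynomial.cyclotomic.irreducible_rat hjpos
    by_cases hdvd : Polynomial.cyclotomic j ℚ ∣ E
    · -- `E = Ψ_j E₁`: lower the allowance of `Ψ_j` by one and induct
      obtain ⟨E₁, rfl⟩ := hdvd
      have hE₁ : E₁ ∣ (t.map fun k => Polynomial.cyclotomic k ℚ).prod :=
        (mul_dvd_mul_iff_left (Polynomial.cyclotomic_ne_zero j ℚ)).1 hE
      have hfj : 1 ≤ f j := hb j hjpos 1 (by rw [pow_one]; exact dvd_mul_right _ _)
      have hb₁ : ∀ k, 1 ≤ k → ∀ α, Polynomial.cyclotomic k ℚ ^ α ∣ E₁ →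
          α ≤ Function.update f j (f j - 1) k := by
        intro k hk α hα
        by_cases hkj : k = j
        · rw [hkj] at hα ⊢
          rw [Function.update_self]
          have h' : Polynomial.cyclotomic j ℚ ^ (α + 1) ∣ Polynomial.cyclotomic j ℚ * E₁ := by
            rw [pow_succ']
            exact mul_dvd_mul_left _ hα
          have := hb j hjpos (α + 1) h'
          omega
        · rw [Function.update_of_ne hkj]
          exact hb k hk α (hα.trans (dvd_mul_left _ _))
      have hsplit : ∀ φ : ℕ → ℕ, ∏ k ∈ F, Polynomial.cyclotomic k ℚ ^ φ k =
          Polynomial.cyclotomic j ℚ ^ φ j *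
            ∏ k ∈ F.erase j, Polynomial.cyclotomic k ℚ ^ φ k :=
        fun φ => (Finset.mul_prod_erase F (fun k => Polynomial.cyclotomic k ℚ ^ φ k) hF.1).symm
      have h₁ := ih E₁ (Function.update f j (f j - 1)) F hF.2 hE₁ hb₁
      rw [hsplit, Function.update_self,
        Finset.prod_congr rfl fun k hk => by rw [Function.update_of_ne (Finset.ne_of_mem_erase hk)]]
        at h₁
      rw [hsplit]
      calc Polynomial.cyclotomic j ℚ * E₁
          ∣ Polynomial.cyclotomic j ℚ * (Polynomial.cyclotomic j ℚ ^ (f j - 1) *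
              ∏ k ∈ F.erase j, Polynomial.cyclotomic k ℚ ^ f k) := mul_dvd_mul_left _ h₁
        _ = Polynomial.cyclotomic j ℚ ^ f j * ∏ k ∈ F.erase j, Polynomial.cyclotomic k ℚ ^ f k := by
          rw [← mul_assoc, ← pow_succ', Nat.sub_add_cancel hfj]
    · -- `Ψ_j ∤ E`: `E` is coprime to `Ψ_j` and divides the rest
      have hcop : IsCoprime (Polynomial.cyclotomic j ℚ) E := hirr.coprime_iff_not_dvd.2 hdvd
      exact ih E f F hF.2 (hcop.symm.dvd_of_dvd_mul_left hE) hb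

/-! ### Corollary 13 -/

/-- **Rechnitzer 2006, Corollary 13, from its printed inputs**: Theorem 1 (proved:
`Rechnitzer2006_thm1_holds`), Theorem 6, Lemma 10 and Theorem 12 imply
`B_n(x) · H_n(x) ∈ ℚ[x]` with `B_n = ∏_{k=1}^{⌈n/3⌉} Ψ_k^{2n-6k+5}` (`denomBound n`), i.e.
`D_n ∣ B_n` for the lowest-terms denominator `D_n` of `H_n`: "The factor of `Ψ_k(x)` in the
denominator, `D_n(x)` of `H_n(x)` may not appear with a power greater than `2n-6k+5` … This
follows by combining the results of Theorems 1, 6 and 12" (with `2n = 6k-4+2M`, `2M+1 = 2n-6k+5`;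
the range `k ≤ ⌈n/3⌉` by Lemma 10). [cite: Rechnitzer2006Haruspicy2, Corollary 13] -/
theorem Rechnitzer2006_cor13_of_thm6_lem10_thm12 (h6 : Rechnitzer2006_thm6)
    (h10 : Rechnitzer2006_lem10) (h12 : Rechnitzer2006_thm12) : Rechnitzer2006_cor13 := by
  classical
  intro n hn
  obtain ⟨N', s, -, hND⟩ := Rechnitzer2006_thm1_holds n
  set D' : ℚ[X] := (s.map fun k => Polynomial.cyclotomic k ℚ).prod with hD'
  have hD'0 : D' ≠ 0 := by
    refine Multiset.prod_ne_zero fun h0 => ?_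
    obtain ⟨k, -, hk⟩ := Multiset.mem_map.1 h0
    exact Polynomial.cyclotomic_ne_zero k ℚ hk
  -- lowest terms `H_n = N / D`
  set g : ℚ[X] := GCDMonoid.gcd N' D' with hg
  have hg0 : g ≠ 0 := gcd_ne_zero_of_right hD'0
  have hDg : D' = g * (D' / g) :=
    (EuclideanDomain.mul_div_cancel' hg0 (GCDMonoid.gcd_dvd_right N' D')).symm
  have hNg : N' = g * (N' / g) :=
    (EuclideanDomain.mul_div_cancel' hg0 (GCDMonoid.gcd_dvd_left N' D')).symm
  set D : ℚ[X] := D' / g with hD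
  set N : ℚ[X] := N' / g with hN
  have hrep : (D : PowerSeries ℚ) * sapRowGF ℚ n = N := by
    have hg' : ((g : ℚ[X]) : PowerSeries ℚ) ≠ 0 := by simpa using hg0
    apply mul_left_cancel₀ hg'
    rw [← mul_assoc, ← Polynomial.coe_mul, ← hDg, ← Polynomial.coe_mul, ← hNg, hND]
  have hcop : IsCoprime N D := isCoprime_div_gcd_div_gcd hD'0
  have hDD' : D ∣ D' := ⟨g, by rw [mul_comm]; exact hDg⟩
  -- the exponents of `B_n`
  set e : ℕ → ℕ := fun k => if k ∈ Finset.Icc 1 ((n + 2) / 3) then 2 * n + 5 - 6 * k else 0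
    with he
  -- the exponent of `Ψ_k` in `D` is at most `e k` (Theorem 6, then Theorem 12 or Lemma 10)
  have hbound : ∀ k, 1 ≤ k → ∀ α, Polynomial.cyclotomic k ℚ ^ α ∣ D → α ≤ e k := by
    intro k hk α hα
    rcases Nat.eq_zero_or_pos α with rfl | hαpos
    · exact Nat.zero_le _
    obtain ⟨w, hw, hαle⟩ := h6 n k α hn hk hαpos N D hcop hrep hα
    obtain ⟨hcan, hsm, hvc⟩ := mem_smWords.1 hw
    by_cases h3 : 3 * k ≤ n + 2
    · -- Theorem 12 with `M = n + 2 - 3k`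
      have hmem : k ∈ Finset.Icc 1 ((n + 2) / 3) :=
        Finset.mem_Icc.2 ⟨hk, (Nat.le_div_iff_mul_le (by norm_num)).2 (by omega)⟩
      have hek : e k = 2 * n + 5 - 6 * k := by simp only [he, hmem, if_true]
      have hv : vcount w = 6 * k - 4 + 2 * (n + 2 - 3 * k) := by omega
      have h12' := h12 w hcan hsm k (n + 2 - 3 * k) hk hv
      have hsub : ((sections w).filter fun s => 2 * k ∣ (secHeights w s.1 s.2).card) ⊆
          ((sections w).filter fun s => 2 * k ≤ (secHeights w s.1 s.2).card) := by
        intro s hs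
        rw [Finset.mem_filter] at hs ⊢
        exact ⟨hs.1, Nat.le_of_dvd (card_secHeights_pos hs.1) hs.2⟩
      have hcard := Finset.card_le_card hsub
      rw [hek]
      omega
    · -- Lemma 10: a section with `2K` bonds, `k ∣ K`, needs `6K - 4 ≤ 2n`, so `3k ≤ n + 2`
      exfalso
      obtain ⟨s, hs⟩ :=
        Finset.card_pos.1 (lt_of_lt_of_le hαpos hαle :
          0 < ((sections w).filter fun s => 2 * k ∣ (secHeights w s.1 s.2).card).card)
      rw [Finset.mem_filter] at hs
      obtain ⟨q, hq⟩ := hs.2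
      have hpos := card_secHeights_pos hs.1
      have hqpos : 0 < q := by
        rcases Nat.eq_zero_or_pos q with rfl | h
        · rw [hq, mul_zero] at hpos
          exact absurd hpos (lt_irrefl 0)
        · exact h
      have h10' := h10 w hcan (k * q) (mul_pos hk hqpos) ⟨s, hs.1, by rw [hq]; ring⟩
      have hkq : k ≤ k * q := Nat.le_mul_of_pos_right k hqpos
      omega
  -- hence `D ∣ B_n`
  have hDB : D ∣ denomBound n := by
    have h1 := dvd_prod_cyclotomic_pow_of_forall_le s D e
      (s.toFinset ∪ Finset.Icc 1 ((n + 2) / 3)) Finset.subset_union_left hDD' hbound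
    refine h1.trans (dvd_of_eq ?_)
    rw [denomBound, ← Finset.prod_subset (Finset.subset_union_right (s₁ := s.toFinset))
      (fun k _ hk => by simp only [he, hk, if_false, pow_zero])]
    refine Finset.prod_congr rfl fun k hk => ?_
    simp only [he, hk, if_true]
  -- and `B_n H_n = (B_n / D) N`
  obtain ⟨Q, hQ⟩ := hDB
  refine ⟨Q * N, ?_⟩
  rw [hQ, Polynomial.coe_mul, Polynomial.coe_mul, mul_assoc, mul_left_comm, hrep]

end Literature.Barriers.CriticalPhenomena
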